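import Summits.CriticalPhenomena.PercolationContinuityZ3.Theses.PercShatteringRace
import Summits.CriticalPhenomena.PercolationContinuityZ3.Theorems.NearLinearTwoClusterDecay.Negative.SlabTiling
import Literature.Probability.Percolation.SharpnessDCTProofs
import Literature.Probability.Percolation.LatticeSymmetry
import Literature.Probability.Percolation.HalfSpaceBrickSymmetry
import Literature.Probability.Percolation.HalfSpacePinnedPairs
import HarnessLib

/-!
# Crux `PercShatteringRace.NearLinearTwoClusterDecay` (stmt-CriticalPhenomena-5785), line `critical-orange-peeling` — stub `face_le_of_plates`

Helper file for the lead's skeleton of the line `critical-orange-peeling` (van den Berg–van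
Engelenburg 2022 programme, bounded aspect; arXiv:2009.13337, Lemma 6 / Prop. 2, bond version on
`ℤ³`) of the crux
`Summit.CriticalPhenomena.PercolationContinuityZ3.Theses.PercShatteringRace.NearLinearTwoClusterDecay`.
Proves exactly the registered stub signature `face_le_of_plates` (item V7c of the skeleton,
"plate tiling + Harris", the square-root-trick direction); lands with
`--supports stmt-CriticalPhenomena-5785`.

## The statement

Bond percolation `P_p` on `ℤ³`, any `p`; `Λ(b) = box 3 b = [-b, b]³`. For `1 ≤ a ≤ b` let
* `E⁺₂(a, b)` = "there is an open path inside `Λ(b) ∩ {v₂ ≥ a}` from the layer `{v₂ = a}` of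
  `Λ(b)` to its top layer `{v₂ = b}`";
* `F⁺(a, b)` = "there is an open path inside the HALF-SPACE `{v₂ ≥ a}` from the small plate
  `[-a, a]² × {a}` to the plane `{v₂ = b}`".
Then `P_p(E⁺₂(a, b)) ≤ 1 - (1 - P_p(F⁺(a, b)))^J`, `J = (2 ⌊b/a⌋ + 3)²`.

## The argument

* TILES. For `z ∈ box 2 (⌊b/a⌋ + 1)` put `c_z = (a z₀, a z₁, 0)` and let `T_v` be the translate by
  `v` of `F⁺(a, b)`, written as the open crossing `openCrossing (H + v) (Π + v) (L + v)` of the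
  translated half-space `H = {v₂ ≥ a}`, plate `Π = [-a, a]² × {a}` and plane `L = {v₂ = b}`;
  `P_p(T_v) = P_p(F⁺(a, b))` by translation invariance (`real_openCrossing_shift`).
* INCLUSION `E⁺₂(a, b) ⊆ ⋃_z T_{c_z}` (`PlateCrossing.mem_biUnion_of_mem_face`, for EVERY
  configuration). The `E`-path starts at `x` with `x₂ = a`, `|x₀|, |x₁| ≤ b`; round down to the
  grid, `z = (⌊x₀/a⌋, ⌊x₁/a⌋)` (`SlabTiling.round_bounds`): `|x₀ - a z₀|, |x₁ - a z₁| ≤ a`,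
  `|zᵢ| ≤ ⌊b/a⌋ + 1`, i.e. `x ∈ Π + c_z`; the path stays inside `Λ(b) ∩ {v₂ ≥ a} ⊆ H = H + c_z`
  and ends on `{v₂ = b} = L + c_z` (`openConnIn_mono`).
* HARRIS (`PlateCrossing.real_biUnion_shift_le_one_sub_pow`). The `T_v` are increasing
  (`isUpperSet_openCrossing`) and measurable (countable unions of the events `{x ↔ y in S}`,
  `measurableSet_openConnIn_of_countable`), so their complements are decreasing and positively
  correlated: `P_p(⋂_v T_vᶜ) ≥ ∏_v P_p(T_vᶜ) = (1 - P_p(F⁺(a, b)))^{|I|}`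
  (`prob_biInter_ge_prod_of_isLowerSet`, Grimmett 1999 Thm. 2.4), whence
  `P_p(⋃_{v ∈ I} T_v) ≤ 1 - (1 - P_p(F⁺(a, b)))^{|I|}`; finally `|I| ≤ |box 2 (⌊b/a⌋ + 1)| = J`
  (`card_box`) and `0 ≤ 1 - P_p(F⁺) ≤ 1`.

No new definitions (the index set is an explicit `Finset.image` of `box 2 (⌊b/a⌋ + 1)`; the
events are written inline). The hypothesis `a ≤ b` is not needed.
-/

noncomputable section

namespace Summit.CriticalPhenomena.PercolationContinuityZ3.Theorems.NearLinearTwoClusterDecay.Negative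

open MeasureTheory Filter Topology
open Literature.Probability.LatticeModels Literature.Probability.Percolation
open Literature.Probability.Percolation.DCT16

namespace PlateCrossing

/-! ### Geometry: translates, and the inclusion `E⁺₂(a, b) ⊆ ⋃_z T_{c_z}` -/

/-- Membership in a translated set of sites: `z ∈ S + v ↔ z - v ∈ S`. -/
theorem mem_image_add_iff {d : ℕ} (v z : Site d) (S : Set (Site d)) :
    z ∈ (· + v) '' S ↔ z - v ∈ S := by
  constructor
  · rintro ⟨w, hw, rfl⟩
    simpa only [add_sub_cancel_right] using hw
  · intro h
    exact ⟨z - v, h, sub_add_cancel z v⟩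

/-- **The plate event as an open crossing.** `F⁺(a, b)` is, verbatim, the open crossing event
`openCrossing H Π L` of the half-space `H = {v₂ ≥ a}` from the plate `Π = [-a, a]² × {a}` to the
plane `L = {v₂ = b}`. -/
theorem openCrossing_plate_eq (a b : ℕ) :
    openCrossing {v : Site 3 | (a : ℤ) ≤ v 2}
        {x : Site 3 | |x 0| ≤ (a : ℤ) ∧ |x 1| ≤ (a : ℤ) ∧ x 2 = (a : ℤ)}
        {y : Site 3 | y 2 = (b : ℤ)} =
      {ω | ∃ x : Site 3, |x 0| ≤ (a : ℤ) ∧ |x 1| ≤ (a : ℤ) ∧ x 2 = (a : ℤ) ∧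
          ∃ y : Site 3, y 2 = (b : ℤ) ∧ ω ∈ openConnIn {v : Site 3 | (a : ℤ) ≤ v 2} x y} := by
  ext ω
  simp only [mem_openCrossing_iff, Set.mem_setOf_eq, and_assoc]

/-- **Inclusion `E⁺₂(a, b) ⊆ ⋃_z T_{c_z}`** (every configuration, `a ≥ 1`). Let `ω` contain an
open path inside `Λ(b) ∩ {v₂ ≥ a}` from `x` (`x₂ = a`, `|x₀|, |x₁| ≤ b`) to `y` (`y₂ = b`). With
`z = (⌊x₀/a⌋, ⌊x₁/a⌋) ∈ box 2 (⌊b/a⌋ + 1)` (`SlabTiling.round_bounds`) and `c_z = (a z₀, a z₁, 0)`: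
`x ∈ Π + c_z`, `y ∈ L + c_z = L`, and the path lies inside `Λ(b) ∩ {v₂ ≥ a} ⊆ H + c_z = H`
(`openConnIn_mono`), so `ω ∈ T_{c_z}`. -/
theorem mem_biUnion_of_mem_face {a b : ℕ} (ha : 1 ≤ a) {ω : BondConfig (Site 3)}
    (hE : ω ∈ {ω | ∃ x ∈ (box 3 b).filter (fun v => v 2 = (a : ℤ)),
      ∃ y ∈ (box 3 b).filter (fun v => v 2 = (b : ℤ)),
        ω ∈ openConnIn (↑((box 3 b).filter (fun v => (a : ℤ) ≤ v 2)) : Set (Site 3)) x y}) :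
    ω ∈ ⋃ v ∈ (box 2 (b / a + 1)).image
        (fun z : Site 2 => (![(a : ℤ) * z 0, (a : ℤ) * z 1, 0] : Site 3)),
      openCrossing ((· + v) '' {w : Site 3 | (a : ℤ) ≤ w 2})
        ((· + v) '' {x : Site 3 | |x 0| ≤ (a : ℤ) ∧ |x 1| ≤ (a : ℤ) ∧ x 2 = (a : ℤ)})
        ((· + v) '' {y : Site 3 | y 2 = (b : ℤ)}) := by
  obtain ⟨x, hx, y, hy, hxy⟩ := hE
  rw [Finset.mem_filter, mem_box] at hx hy
  obtain ⟨hxb, hx2⟩ := hx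
  obtain ⟨-, hy2⟩ := hy
  obtain ⟨⟨hr0, hr0'⟩, hz0, hz0'⟩ := SlabTiling.round_bounds ha (hxb 0).1 (hxb 0).2
  obtain ⟨⟨hr1, hr1'⟩, hz1, hz1'⟩ := SlabTiling.round_bounds ha (hxb 1).1 (hxb 1).2
  have hz : (![x 0 / (a : ℤ), x 1 / (a : ℤ)] : Site 2) ∈ box 2 (b / a + 1) := by
    rw [mem_box]
    intro i
    fin_cases i
    · exact ⟨hz0, hz0'⟩
    · exact ⟨hz1, hz1'⟩
  refine Set.mem_biUnion (Finset.mem_coe.2 (Finset.mem_image_of_mem _ hz)) ?_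
  refine ⟨x, (mem_image_add_iff _ x _).2 ?_, y, (mem_image_add_iff _ y _).2 ?_,
    openConnIn_mono (fun v hv => (mem_image_add_iff _ v _).2 ?_) x y hxy⟩
  · simp only [Set.mem_setOf_eq, Pi.sub_apply, Matrix.cons_val_zero, Matrix.cons_val_one,
      Matrix.cons_val]
    exact ⟨abs_le.2 ⟨by omega, by omega⟩, abs_le.2 ⟨by omega, by omega⟩, by omega⟩
  · simp only [Set.mem_setOf_eq, Pi.sub_apply, Matrix.cons_val]
    omega
  · have hv' := (Finset.mem_filter.1 (Finset.mem_coe.1 hv)).2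
    simp only [Set.mem_setOf_eq, Pi.sub_apply, Matrix.cons_val]
    omega

/-! ### Probability: Harris–FKG for the complements of translated open crossings -/

/-- **Union of translated open crossings, by Harris–FKG.** For all sets `S, A, B ⊆ ℤ^d` and every
finite set `I` of translation vectors,
`P_p(⋃_{v ∈ I} C(S + v; A + v, B + v)) ≤ 1 - (1 - P_p(C(S; A, B)))^{|I|}`: the open crossing
events are increasing (`isUpperSet_openCrossing`) and measurable (countable unions over the
endpoints of the events `{x ↔ y in S + v}`, `measurableSet_openConnIn_of_countable`), so their
complements are decreasing measurable events and `P_p(⋂_v C_vᶜ) ≥ ∏_v P_p(C_vᶜ)`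
(`prob_biInter_ge_prod_of_isLowerSet`, Grimmett 1999, Thm. 2.4 for decreasing events), while
`P_p(C_vᶜ) = 1 - P_p(C(S; A, B))` by translation invariance (`real_openCrossing_shift`). -/
theorem real_biUnion_shift_le_one_sub_pow {d : ℕ} (p : unitInterval) (S A B : Set (Site d))
    (I : Finset (Site d)) :
    (bondPercolation (zdGraph d) p).real
        (⋃ v ∈ I, openCrossing ((· + v) '' S) ((· + v) '' A) ((· + v) '' B)) ≤
      1 - (1 - (bondPercolation (zdGraph d) p).real (openCrossing S A B)) ^ I.card := by
  classical
  have hTm : ∀ v : Site d,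
      MeasurableSet (openCrossing ((· + v) '' S) ((· + v) '' A) ((· + v) '' B)) := fun v => by
    have h : openCrossing ((· + v) '' S) ((· + v) '' A) ((· + v) '' B) =
        ⋃ x ∈ (· + v) '' A, ⋃ y ∈ (· + v) '' B,
          (openConnIn ((· + v) '' S) x y : Set (BondConfig (Site d))) := by
      ext ω
      simp only [mem_openCrossing_iff, Set.mem_iUnion, exists_prop]
    rw [h]
    exact MeasurableSet.biUnion (Set.to_countable _) fun x _ =>
      MeasurableSet.biUnion (Set.to_countable _) fun y _ =>
        measurableSet_openConnIn_of_countable _ x y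
  have hprod := prob_biInter_ge_prod_of_isLowerSet (zdGraph d) p I
    (fun v => (openCrossing ((· + v) '' S) ((· + v) '' A) ((· + v) '' B))ᶜ)
    (fun v _ => (isUpperSet_openCrossing _ _ _).compl) (fun v _ => (hTm v).compl)
  have hcompl : ∀ v ∈ I, (bondPercolation (zdGraph d) p).real
      (openCrossing ((· + v) '' S) ((· + v) '' A) ((· + v) '' B))ᶜ =
      1 - (bondPercolation (zdGraph d) p).real (openCrossing S A B) := fun v _ => by
    rw [probReal_compl_eq_one_sub (hTm v), real_openCrossing_shift p v S A B]
  rw [Finset.prod_congr rfl hcompl, Finset.prod_const] at hprod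
  have hU := probReal_compl_eq_one_sub (μ := bondPercolation (zdGraph d) p)
    (Finset.measurableSet_biUnion I fun v _ => hTm v)
  rw [Set.compl_iUnion₂] at hU
  linarith

end PlateCrossing

/-- **Registered stub `face_le_of_plates`** (line `critical-orange-peeling`, crux
`NearLinearTwoClusterDecay`, vdBvE programme V7c): for bond percolation on `ℤ³` (every `p`) and
`1 ≤ a ≤ b`, the probability of an open path inside `Λ(b) ∩ {v₂ ≥ a}` from the layer `{v₂ = a}`
to the layer `{v₂ = b}` is at most `1 - (1 - P_p(F⁺(a, b)))^J`, `J = (2 ⌊b/a⌋ + 3)²`, where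
`F⁺(a, b)` is the event of an open path inside the half-space `{v₂ ≥ a}` from the plate
`[-a, a]² × {a}` to the plane `{v₂ = b}`. Proof: the face crossing starts in some translated plate
`Π + c_z`, `z ∈ box 2 (⌊b/a⌋ + 1)`, and is itself a half-space crossing to the plane
(`PlateCrossing.mem_biUnion_of_mem_face`), so `E⁺₂ ⊆ ⋃_z T_{c_z}`; Harris–FKG for the
decreasing complements of the translates (`PlateCrossing.real_biUnion_shift_le_one_sub_pow`,
translation invariance `real_openCrossing_shift`) and `|box 2 (⌊b/a⌋ + 1)| = J` (`card_box`). -/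
theorem face_le_of_plates : ∀ (p : unitInterval) (a b : ℕ), 1 ≤ a → a ≤ b →
    (bondPercolation (zdGraph 3) p).real
        {ω | ∃ x ∈ (box 3 b).filter (fun v => v 2 = (a : ℤ)), ∃ y ∈ (box 3 b).filter (fun v => v 2 = (b : ℤ)),
          ω ∈ openConnIn (↑((box 3 b).filter (fun v => (a : ℤ) ≤ v 2)) : Set (Site 3)) x y} ≤
      1 - (1 - (bondPercolation (zdGraph 3) p).real
        {ω | ∃ x : Site 3, |x 0| ≤ (a : ℤ) ∧ |x 1| ≤ (a : ℤ) ∧ x 2 = (a : ℤ) ∧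
          ∃ y : Site 3, y 2 = (b : ℤ) ∧ ω ∈ openConnIn {v : Site 3 | (a : ℤ) ≤ v 2} x y}) ^ ((2 * (b / a) + 3) ^ 2) := by
  classical
  intro p a b ha _
  rw [← PlateCrossing.openCrossing_plate_eq a b]
  have hw0 : 0 ≤ 1 - (bondPercolation (zdGraph 3) p).real
      (openCrossing {v : Site 3 | (a : ℤ) ≤ v 2}
        {x : Site 3 | |x 0| ≤ (a : ℤ) ∧ |x 1| ≤ (a : ℤ) ∧ x 2 = (a : ℤ)}
        {y : Site 3 | y 2 = (b : ℤ)}) := sub_nonneg.2 measureReal_le_one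
  have hw1 : 1 - (bondPercolation (zdGraph 3) p).real
      (openCrossing {v : Site 3 | (a : ℤ) ≤ v 2}
        {x : Site 3 | |x 0| ≤ (a : ℤ) ∧ |x 1| ≤ (a : ℤ) ∧ x 2 = (a : ℤ)}
        {y : Site 3 | y 2 = (b : ℤ)}) ≤ 1 := sub_le_self _ measureReal_nonneg
  have hK : ((box 2 (b / a + 1)).image fun z : Site 2 =>
      (![(a : ℤ) * z 0, (a : ℤ) * z 1, 0] : Site 3)).card ≤ (2 * (b / a) + 3) ^ 2 :=
    calc _ ≤ (box 2 (b / a + 1)).card := Finset.card_image_le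
      _ = (2 * (b / a + 1) + 1) ^ 2 := card_box 2 _
      _ = (2 * (b / a) + 3) ^ 2 := by ring
  calc _ ≤ (bondPercolation (zdGraph 3) p).real (⋃ v ∈ (box 2 (b / a + 1)).image
          (fun z : Site 2 => (![(a : ℤ) * z 0, (a : ℤ) * z 1, 0] : Site 3)),
        openCrossing ((· + v) '' {w : Site 3 | (a : ℤ) ≤ w 2})
          ((· + v) '' {x : Site 3 | |x 0| ≤ (a : ℤ) ∧ |x 1| ≤ (a : ℤ) ∧ x 2 = (a : ℤ)})
          ((· + v) '' {y : Site 3 | y 2 = (b : ℤ)})) :=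
        measureReal_mono (fun ω hE => PlateCrossing.mem_biUnion_of_mem_face ha hE)
          (measure_ne_top _ _)
    _ ≤ _ := PlateCrossing.real_biUnion_shift_le_one_sub_pow p _ _ _ _
    _ ≤ _ := by linarith [pow_le_pow_of_le_one hw0 hw1 hK]

end Summit.CriticalPhenomena.PercolationContinuityZ3.Theorems.NearLinearTwoClusterDecay.Negative

end
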